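import Literature.Analysis.FluidPDE.TorusPairReflection
import Literature.MathematicalPhysics.KineticTheory.MetropolisOddStatistic
import Literature.MathematicalPhysics.KineticTheory.HardSphereCampbellAssembly
import Literature.MathematicalPhysics.KineticTheory.HardSphereEulerProofs
import HarnessLib

/-!
# SKETCH (crux workfile, `sorry` allowed) — piece P3 of S1a: invariance of the Gibbs-weighted outgoing contact flux under `J*`

Crux `JParityClosure.OddContactSymmetry` (stmt-AtomisticToContinuum-17722), line `KineticSlabSketch`, lead
`prover-line-stmt-AtomisticToContinuum-17722-c1-0` (cycle 2).  The kinematic half of piece P3 is LANDED: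
`Literature/Analysis/FluidPDE/TorusPairReflection.lean` (p148727) — `pairReflect i j ω` (positions point-reflected about `x_j`,
pair velocities `reflectVel ω`), with `pairReflect_pairReflect` (involution), `euclidDist_pairReflect` /
`pairReflect_mem_hardSphereDomain_iff` (isometry, hard core), `configEnergy_pairReflect` (energy, hence the canonical Gibbs
density), `inner_neg_pairReflect_vel_sub` (flux factor), `sepVec_pairReflect_of_contact` (contact flip `εω ↦ −εω`) and
`oddMark_pairReflect_of_contact` (every J-odd mark `Ψ(ε⁻¹ sepVec x_i x_j, pre)` changes sign) ALL PROVED.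

What remains of P3 (the ONE `sorry` below, for a stub-prover): the change of variables inside `outgoingCollisionFlux`.
Ingredients in tree: `measurePreserving_neg_sphere` (`SphereMeasureSymmetry`: `ω ↦ −ω` preserves `volume.toSphere`); Haar
invariance of `x ↦ 2a − x` on `UnitAddTorus d` (translation ∘ negation; `MeasureTheory.Measure.IsNegInvariant`,
`measurePreserving_add_left`), applied fibrewise over `x_j` (Fubini / `MeasurePreserving.skew_product`); the linear isometry
`reflectVel ω` of `V3 × V3` (`LinearIsometryEquiv.measurePreserving`); and the commutation
`pairReflect i j ω (contactInsert ε i j ω z) = contactInsert ε i j (−ω) (pairReflect⁰ i j ω z)` where `pairReflect⁰` is the same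
map read BEFORE insertion (the inserted position of `i` is overwritten, its velocity is kept by `contactInsert`).
Consequence (P3 proper, then S1a with P1 p146817, P2 p145665, P4, P5 p146757):
`2 · Flux_G[metroOddMark] = Flux_G[g · Ψ · (χ(x_i) w − χ(x_j − εω) (w ∘ J*))]`, whence
`|Flux_G[metroOddMark]| ≤ ½ C_g C_Ψ (ω_χ(2ε) Flux_G[1] + C_χ Flux_G|w − w ∘ J*|)`.
-/

noncomputable section

open scoped BigOperators Classical InnerProductSpace ENNReal Topology
open Set MeasureTheory Filter
open Literature.Analysis.FluidPDE Literature.MathematicalPhysics.KineticTheory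

namespace Summit.AtomisticToContinuum.HydrodynamicLimit.Cruxes.OddContactSymmetry.P3Sketch

/-- **P3 proper (to land): invariance of the Gibbs-weighted outgoing contact flux under `J* = pairReflect`.**  For the
canonical Gibbs density `ρ_G` of constant profiles (energy function × hard-core indicator) and every measurable `F ≥ 0`,
`flux(ρ_G · (F ∘ J*)) = flux(ρ_G · F)`, where inside the flux integrand the configuration is `contactInsert ε i j ω z`
(so `sepVec x_i x_j = εω` and `J*` is read with THAT `ω = ε⁻¹ sepVec x_i x_j`). -/
theorem outgoingCollisionFlux_pairReflect {σ : ℝ} (hσ : 0 < σ) (hσ2 : σ < 1 / 2) (a θ : ℝ) (u : V3) (N : ℕ)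
    {F : Config (N + 1) (Fin 3) T3 → Fin (N + 1) → Fin (N + 1) → ℝ≥0∞} (hF : ∀ i j, Measurable fun w => F w i j) :
    outgoingCollisionFlux (hsDiameter σ N) (N + 1)
        (fun w i j => ENNReal.ofReal (canonicalDensity (Torus.geometry (Fin 3)) (hsDiameter σ N) (N + 1)
          (localGibbsProfile (fun _ => a) (fun _ => u) (fun _ => θ)) w) *
          F (pairReflect i j ((hsDiameter σ N)⁻¹ • (Torus.geometry (Fin 3)).sepVec (w i).1 (w j).1) w) i j) =
      outgoingCollisionFlux (hsDiameter σ N) (N + 1)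
        (fun w i j => ENNReal.ofReal (canonicalDensity (Torus.geometry (Fin 3)) (hsDiameter σ N) (N + 1)
          (localGibbsProfile (fun _ => a) (fun _ => u) (fun _ => θ)) w) * F w i j) := by
  sorry

/-- **The parity identity for a Gibbs contact flux (from the invariance): `Flux_G[F] = Flux_G[F ∘ J*]`, hence for an
`F` that is ODD under `J*` on contact configurations the flux vanishes, and in general
`2 Flux_G[F] = Flux_G[F + F ∘ J*]` — the form in which S1a consumes it (with `F = metroOddMark⁺/⁻` parts).  Bookkeeping only,
once `outgoingCollisionFlux_pairReflect` is proved. -/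
theorem two_mul_outgoingCollisionFlux_eq {σ : ℝ} (hσ : 0 < σ) (hσ2 : σ < 1 / 2) (a θ : ℝ) (u : V3) (N : ℕ)
    {F : Config (N + 1) (Fin 3) T3 → Fin (N + 1) → Fin (N + 1) → ℝ≥0∞} (hF : ∀ i j, Measurable fun w => F w i j)
    (_hFJ : ∀ i j, Measurable fun w =>
      F (pairReflect i j ((hsDiameter σ N)⁻¹ • (Torus.geometry (Fin 3)).sepVec (w i).1 (w j).1) w) i j) :
    2 * outgoingCollisionFlux (hsDiameter σ N) (N + 1)
        (fun w i j => ENNReal.ofReal (canonicalDensity (Torus.geometry (Fin 3)) (hsDiameter σ N) (N + 1)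
          (localGibbsProfile (fun _ => a) (fun _ => u) (fun _ => θ)) w) * F w i j) =
      outgoingCollisionFlux (hsDiameter σ N) (N + 1)
        (fun w i j => ENNReal.ofReal (canonicalDensity (Torus.geometry (Fin 3)) (hsDiameter σ N) (N + 1)
          (localGibbsProfile (fun _ => a) (fun _ => u) (fun _ => θ)) w) *
          (F w i j + F (pairReflect i j ((hsDiameter σ N)⁻¹ • (Torus.geometry (Fin 3)).sepVec (w i).1 (w j).1) w) i j)) := by
  have hρ : Measurable fun w => ENNReal.ofReal (canonicalDensity (Torus.geometry (Fin 3)) (hsDiameter σ N) (N + 1)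
      (localGibbsProfile (fun _ => a) (fun _ => u) (fun _ => θ)) w) :=
    (measurable_canonicalDensity _ _
      (measurable_localGibbsProfile continuous_const continuous_const continuous_const)).ennreal_ofReal
  have hadd := outgoingCollisionFlux_add (hsDiameter σ N) (N + 1)
    (g := fun w i j => ENNReal.ofReal (canonicalDensity (Torus.geometry (Fin 3)) (hsDiameter σ N) (N + 1)
          (localGibbsProfile (fun _ => a) (fun _ => u) (fun _ => θ)) w) * F w i j)
    (g' := fun w i j => ENNReal.ofReal (canonicalDensity (Torus.geometry (Fin 3)) (hsDiameter σ N) (N + 1)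
          (localGibbsProfile (fun _ => a) (fun _ => u) (fun _ => θ)) w) *
          F (pairReflect i j ((hsDiameter σ N)⁻¹ • (Torus.geometry (Fin 3)).sepVec (w i).1 (w j).1) w) i j)
    (fun i j => hρ.mul (hF i j))
  rw [outgoingCollisionFlux_pairReflect hσ hσ2 a θ u N hF, ← two_mul] at hadd
  rw [← hadd]
  congr 1
  funext w i j
  rw [mul_add]

end Summit.AtomisticToContinuum.HydrodynamicLimit.Cruxes.OddContactSymmetry.P3Sketch

end
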